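import Summits.AtomisticToContinuum.Crystallization.Theorems.FrustratedLawDichotomyStrainedPatchHomForceCentredHcp

/-!
# (C′-2) FORCE/EXEMPT PRUNE, centred form — the SELF-DIRECTED leaf `forceOutAuto` (the kernel picks the move direction) and its hcp verdict
# (27623 strained-patch piece, hcp half; decomp-a2c hand-2 g28)

`…HomForceCentredHcp.forceMenuC` tries eight fixed directions (`||` is lazy, but a leaf whose firing direction comes last costs eight fold
evaluations ≈ 8 × 130 s in the kernel).  Since `forceOutC0_sound` holds for ANY direction that passes `dirOK`, the direction may be COMPUTED by the
kernel from the box centre: the net Lennard-Jones force on the centre atom, `f = Σ_v Φ(‖v‖²)·v` over the two nearest shells (thin centre data,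
labels `[−3,3]³` cut at `5/2`, both families), scaled to `‖e‖ ≈ 0.99` by an integer square root.  The choice is a HEURISTIC — soundness never looks at it.

* §1 `forceLab`, `forceVec`, `forceDir` (the integer direction `en`, denominator `1000`), ★ `forceOutAuto sn sd c w := forceOutC0 (forceDir c) 1000 sn sd c w`,
  `forceOutAuto_sound`;
* §2 ★★ `entryLeafOKHA μ := entryLeafOKHQ μ ∨ (xiBallOK ∧ forceOutAuto 1 10⁶)` (quick verdict first, then ONE centred fold pair), `entryLeafOKHA_sound`,
  `hcpHalf_of_entryTreeHA`, ★★★ `homFloor_of_entryTrees6RBKP_HA` / `homFloor_625_of_entryTrees6RBKP_HA`.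
Definitions computable; 0 sorry; axioms standard; no instances / notation.  `--supports stmt-AtomisticToContinuum-27623`.
-/

namespace Summit.AtomisticToContinuum.Crystallization.Theorems.FrustratedLawDichotomyStrainedPatchHomForceCentredAuto

open scoped BigOperators RealInnerProductSpace
open Literature.Analysis.ValidatedNumerics.Numerics
open Summit.AtomisticToContinuum.Crystallization.Theorems.ChargedEnergyGapNegative (E3)
open Summit.AtomisticToContinuum.Crystallization.Theorems.FrustratedLawDichotomySchurCut (effPot w₄₅ ω₄)
open Summit.AtomisticToContinuum.Crystallization.Theorems.FrustratedLawDichotomyAveragingRuleTightFree (TightNearCap BadNearCap)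
open Summit.AtomisticToContinuum.Crystallization.Theorems.FrustratedLawDichotomyExemptAbsorption (ExemptNear)
open Summit.AtomisticToContinuum.Crystallization.Theorems.FrustratedLawDichotomyStrainedPatchHomSplit
open Summit.AtomisticToContinuum.Crystallization.Theorems.FrustratedLawDichotomyStrainedPatchHomPrunedPolar (homFloor_of_prunedBoxSums_selfAdjoint)
open Summit.AtomisticToContinuum.Crystallization.Theorems.FrustratedLawDichotomyStrainedPatchHomCertTree (CertTree treeOK)
open Summit.AtomisticToContinuum.Crystallization.Theorems.FrustratedLawDichotomyStrainedPatchHomEntryGram (rootC rootW)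
open Summit.AtomisticToContinuum.Crystallization.Theorems.FrustratedLawDichotomyStrainedPatchHomEntryGramHcp (dot3 rootCH rootWH)
open Summit.AtomisticToContinuum.Crystallization.Theorems.FrustratedLawDichotomyStrainedPatchHomEntryTable (muRec muRec_ok)
open Summit.AtomisticToContinuum.Crystallization.Theorems.FrustratedLawDichotomyStrainedPatchHomEntryFlipHcp (HcpDich hcpHalf_of_entryTreeShuf)
open Summit.AtomisticToContinuum.Crystallization.Theorems.FrustratedLawDichotomyStrainedPatchHomEntryTableP (entryLeafOK6RBKP)
open Summit.AtomisticToContinuum.Crystallization.Theorems.FrustratedLawDichotomyStrainedPatchHomLeafTableCheckHcpV (entryLeafOKHVK_sound)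
open Summit.AtomisticToContinuum.Crystallization.Theorems.FrustratedLawDichotomyStrainedPatchHomEntryQuickHcp (entryLeafOKHQ entryLeafOKHQ_imp)
open Summit.AtomisticToContinuum.Crystallization.Theorems.FrustratedLawDichotomyStrainedPatchHomEntryTreeCert (fccHalf_of_entryTree6RBKP)
open Summit.AtomisticToContinuum.Crystallization.Theorems.FrustratedLawDichotomyStrainedPatchHomForceKit (vecA vecB)
open Summit.AtomisticToContinuum.Crystallization.Theorems.FrustratedLawDichotomyStrainedPatchHomForceHcp (xiBallOK norm_le_quarter_of_xiBallOK)
open Summit.AtomisticToContinuum.Crystallization.Theorems.FrustratedLawDichotomyStrainedPatchHomForceCentred (phi0FI cenE cenX forceOutC0)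
open Summit.AtomisticToContinuum.Crystallization.Theorems.FrustratedLawDichotomyStrainedPatchHomForceCentredFinal (forceOutC0_sound)

/-! ## §1. The kernel-chosen direction and the self-directed leaf -/

/-- Scaled (×`2·SC`, midpoint-doubled) force contribution `Φ(‖v‖²)·v` of one displacement with thin components `V0`; `0` if the label sits on the
centre or beyond `5/2`. -/
def forceLab (V0 : Fin 3 → FI) (a : Fin 3) : ℤ :=
  match decide ((dot3 V0 V0).hi ≤ 25 * (SC : ℤ) / 4) with
  | false => 0
  | true =>
    match FI.divPos (FI.ofInt 1) (dot3 V0 V0) with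
    | none => 0
    | some u => ((phi0FI u).mul (V0 a)).lo + ((phi0FI u).mul (V0 a)).hi

/-- The label range `[−3, 3]` (contains every label of both families within `5/2` of the centre). -/
def icc3L : List ℤ := [-3, -2, -1, 0, 1, 2, 3]

/-- Component `a` of the (scaled) net force on the centre atom from both families (labels `[−3,3]³`, cut at `5/2`), thin centre data of the box `c`. -/
def forceVec (c : (Fin 3 × Fin 3) ⊕ Fin 3 → ℤ) (a : Fin 3) : ℤ :=
  icc3L.foldr (fun i s => icc3L.foldr (fun j s' => icc3L.foldr (fun k s'' =>
    s'' + (match decide ((![i, j, k] : Fin 3 → ℤ) = 0) with | true => 0 | false => forceLab (vecA (cenE c) ![i, j, k]) a) +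
      forceLab (vecB (cenE c) (cenX c) ![i, j, k]) a) s') s) 0

/-- ★ The kernel-chosen move direction: the net force scaled to length `≈ 990/1000` by an integer square root (any rounding only affects `dirOK`,
which the leaf re-checks). -/
def forceDir (c : (Fin 3 × Fin 3) ⊕ Fin 3 → ℤ) : Fin 3 → ℤ :=
  let g0 := forceVec c 0
  let g1 := forceVec c 1
  let g2 := forceVec c 2
  let n : ℤ := (Nat.sqrt (g0 * g0 + g1 * g1 + g2 * g2).toNat : ℤ) + 1
  ![990 * g0 / n, 990 * g1 / n, 990 * g2 / n]

/-- ★ **`forceOutAuto`** — the certificate-free centred leaf along the kernel-chosen direction (denominator `1000`), step `sn/sd`.  The three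
components are bound ONCE before the fold (in compiled code `forceDir c` is a closure whose body would otherwise re-run at every access). -/
def forceOutAuto (sn : ℤ) (sd : ℕ) (c w : (Fin 3 × Fin 3) ⊕ Fin 3 → ℤ) : Bool :=
  let e0 := forceDir c 0
  let e1 := forceDir c 1
  let e2 := forceDir c 2
  forceOutC0 ![e0, e1, e2] 1000 sn sd c w

/-- ★ Soundness of `forceOutAuto` (the `hver` prune disjunct on the box), immediate from `forceOutC0_sound`. [folklore] -/
theorem forceOutAuto_sound {sn : ℤ} {sd : ℕ} {c w : (Fin 3 × Fin 3) ⊕ Fin 3 → ℤ} (h : forceOutAuto sn sd c w = true)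
    (U : E3 →L[ℝ] E3) (ξ : E3) (hU : ‖U - 1‖ ≤ 1 / 4) (hξn : ‖ξ‖ ≤ 1 / 4)
    (hbox : ∀ ab : Fin 3 × Fin 3, |(U (EuclideanSpace.single ab.2 (1 : ℝ))) ab.1 - (c (Sum.inl ab) : ℝ) / SC| ≤ (w (Sum.inl ab) : ℝ) / SC)
    (hξ : ∀ i : Fin 3, |ξ i - (c (Sum.inr i) : ℝ) / SC| ≤ (w (Sum.inr i) : ℝ) / SC) :
    ∀ (M : ℕ) (z : Fin M → E3) (cc : Fin M), Function.Injective z →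
      Set.range z = {x : E3 | dist x (z cc) ≤ 133 / 10 ∧ ∃ a : Fin 3 → ℤ,
        x = z cc + latPt U hexFrame a ∨ x = z cc + latPt U hexFrame a + U (hcpShift + ξ)} →
      TightNearCap (9 / 5) (3 / 2) z cc ∨ ExemptNear (9 / 5) ExRec z cc ∨ BadNearCap (9 / 5) (3 / 2) z cc := by
  unfold forceOutAuto at h
  extract_lets e0 e1 e2 at h
  exact forceOutC0_sound h U ξ hU hξn hbox hξ

/-! ## §2. The self-directed hcp verdict and `(H) HomFloor m` -/

/-- ★★ **THE SELF-DIRECTED hcp VERDICT**: quick verdict first, then the shuffle-ball check and ONE centred fold pair along the kernel-chosen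
direction (step `10⁻⁶`). -/
def entryLeafOKHA (μ : ℤ) (c w : (Fin 3 × Fin 3) ⊕ Fin 3 → ℤ) : Bool := entryLeafOKHQ μ c w || (xiBallOK c w && forceOutAuto 1 1000000 c w)

/-- ★★ Soundness of `entryLeafOKHA` in the `hver` shape of `…HomEntryFlipHcp.hcpHalf_of_entryTreeShuf`. [folklore] -/
theorem entryLeafOKHA_sound {μ : ℤ} {c w : (Fin 3 × Fin 3) ⊕ Fin 3 → ℤ} (h : entryLeafOKHA μ c w = true) (U : E3 →L[ℝ] E3) (ξ : E3)
    (hsa : ∀ v v' : E3, ⟪U v, v'⟫ = ⟪v, U v'⟫) (hU : ‖U - 1‖ ≤ 1 / 4)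
    (hbox : ∀ ab : Fin 3 × Fin 3, |(U (EuclideanSpace.single ab.2 (1 : ℝ))) ab.1 - (c (Sum.inl ab) : ℝ) / SC| ≤ (w (Sum.inl ab) : ℝ) / SC)
    (hξ : ∀ i : Fin 3, |ξ i - (c (Sum.inr i) : ℝ) / SC| ≤ (w (Sum.inr i) : ℝ) / SC) (h0 : 0 ≤ ξ 0) (h2 : 0 ≤ ξ 2) :
    (∀ (M : ℕ) (z : Fin M → E3) (cc : Fin M), Function.Injective z →
        Set.range z = {x : E3 | dist x (z cc) ≤ 133 / 10 ∧ ∃ a : Fin 3 → ℤ,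
          x = z cc + latPt U hexFrame a ∨ x = z cc + latPt U hexFrame a + U (hcpShift + ξ)} →
        TightNearCap (9 / 5) (3 / 2) z cc ∨ ExemptNear (9 / 5) ExRec z cc ∨ BadNearCap (9 / 5) (3 / 2) z cc) ∨
      (μ : ℝ) / SC ≤ ∑ b ∈ (Fintype.piFinset fun _ : Fin 3 => Finset.Icc (-7 : ℤ) 7).filter (fun b => b ≠ 0), effPot w₄₅ ω₄ (3 / 400) ‖latPt U hexFrame b‖ +
        ∑ b ∈ (Fintype.piFinset fun _ : Fin 3 => Finset.Icc (-7 : ℤ) 7), effPot w₄₅ ω₄ (3 / 400) ‖latPt U hexFrame b + U (hcpShift + ξ)‖ := by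
  simp only [entryLeafOKHA, Bool.or_eq_true, Bool.and_eq_true] at h
  rcases h with h | ⟨hball, hauto⟩
  · exact entryLeafOKHVK_sound (entryLeafOKHQ_imp μ c w h) U ξ hsa hU hbox hξ h0 h2
  · exact Or.inl (forceOutAuto_sound hauto U ξ hU (norm_le_quarter_of_xiBallOK hball hξ) hbox hξ)

/-- ★★ The hcp half from ONE certificate tree over the self-directed verdict. [folklore] -/
theorem hcpHalf_of_entryTreeHA {m : ℝ} {μ : ℤ} (hμ : 2 * (m + (-(7175 / 10000) + 3 / 400)) * SC ≤ μ) {t : CertTree ((Fin 3 × Fin 3) ⊕ Fin 3)}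
    (h : treeOK (entryLeafOKHA μ) t rootCH rootWH = true) :
    ∀ (U : E3 →L[ℝ] E3) (ξ : E3), (∀ v w : E3, inner ℝ (U v) w = inner ℝ v (U w)) → (∀ w : E3, 0 ≤ inner ℝ w (U w)) →
      ‖U - 1‖ ≤ 1 / 4 → ‖ξ‖ ≤ 1 / 4 → HcpDich m U ξ :=
  hcpHalf_of_entryTreeShuf hμ (entryLeafOKHA μ) (fun _ _ hv U ξ hsa hU hbox hξ h0 h2 => entryLeafOKHA_sound hv U ξ hsa hU hbox hξ h0 h2) h

/-- ★★★ **`(H) HomFloor m` over the SELF-DIRECTED verdict**. [folklore] -/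
theorem homFloor_of_entryTrees6RBKP_HA {m : ℝ} {μ : ℤ} (hμ : 2 * (m + (-(7175 / 10000) + 3 / 400)) * SC ≤ μ)
    (hF : ∃ t : CertTree (Fin 3 × Fin 3), treeOK (entryLeafOK6RBKP μ) t rootC rootW = true)
    (hH : ∃ t : CertTree ((Fin 3 × Fin 3) ⊕ Fin 3), treeOK (entryLeafOKHA μ) t rootCH rootWH = true) : HomFloor m := by
  obtain ⟨tF, htF⟩ := hF
  obtain ⟨tH, htH⟩ := hH
  exact homFloor_of_prunedBoxSums_selfAdjoint (fccHalf_of_entryTree6RBKP hμ htF) (hcpHalf_of_entryTreeHA hμ htH)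

/-- ★★★ **`(H) HomFloor (1/625)` over the self-directed verdict** (`μ = muRec`). [folklore] -/
theorem homFloor_625_of_entryTrees6RBKP_HA
    (hF : ∃ t : CertTree (Fin 3 × Fin 3), treeOK (entryLeafOK6RBKP muRec) t rootC rootW = true)
    (hH : ∃ t : CertTree ((Fin 3 × Fin 3) ⊕ Fin 3), treeOK (entryLeafOKHA muRec) t rootCH rootWH = true) : HomFloor (1 / 625) :=
  homFloor_of_entryTrees6RBKP_HA muRec_ok hF hH

end Summit.AtomisticToContinuum.Crystallization.Theorems.FrustratedLawDichotomyStrainedPatchHomForceCentredAuto
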